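import Literature.MathematicalPhysics.QuantumFieldTheory.Balaban1983to89.Node00.CriticalOnFibreTop
import Literature.MathematicalPhysics.QuantumFieldTheory.Balaban1983to89.B11Prop8Assembly

/-!
# NODE 00 — [15] PROPOSITION 8's HALVING ITERATION (p. 304) AT THE OBJECTS OF RECORD, TOP-DOMAIN MULTI-SCALE CURRENCY: the named fact
# `Prop8RegSepTopStep F N Sup B₃ a₀ a₁` REDUCED to Sect. F's ONE-STEP local improvement `HalvingStepTop F N Sup B₃ a₀ a₁`

Cell `pub-ymgap`, seat `pub-ymgap-dag-n07-e` generation 12 (R141 (C), DAG node N07 = [15] = T. Bałaban, *The variational problem and background fields in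
renormalization group method for lattice gauge theories*, Commun. Math. Phys. **102** (1985) 277–309; cell INBOX INTENT-30 of 2026-08-27 ≈17:00Z).  NEW leaf;
this seat's `Node00.CriticalOnFibreTop` (p524052: `Prop8RegSepTopStep`, `regular_of_isMinimizer_classTop_of_prop8TopStep`) and the `lit-balaban` reader r08's
`B11Prop8Assembly` (abstract halving iteration over `B11.VarProblemX`: `max_half_le`, `stage_le`; `B11.halving_reaches_B3eps1`) CONSUMED BY NAME, nothing modified.
`--kind definition --supports stmt-QuantumFields-20541` (K0⁷; plan g75's skeleton of record V14 names `stub_prop8StepCoP13 : ∃ B₃ a₀ a₁, 2L² ≤ B₃ ∧ … ∧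
Prop8RegSepTopStep F 2 suppDomOfRecord B₃ a₀ a₁` as «Lane dag-n07-e, XL, HARDEST STUB»).

WHY.  Print proves Proposition 8 (p. 304 [PDF 28]: *«There exists a positive, absolute constant a₅ such, that if U is a critical configuration of (5) in the
space (6) with V satisfying (7), and if ε₀ ≦ a₅, then U belongs to the space (8)»*) in TWO moves: (a) the ONE-STEP LOCAL IMPROVEMENT of Sect. F, (144)–(168)
pp. 300–304 — for a unit cube `Δ₀ = B^j(y)` inside a collared big cube `□̃ ⊂ B_{j−1}(Λ_{j−1}) ∪ B_j(Λ_j)` ((144)), [6] Thm 2's gauge (152), the data bound (160),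
the H-kernel bounds (161)–(164), Prop. 6's equation (158) and (165)–(167) give *«U′_k satisfies (2) on Δ₀ with max{B₃ε₁, ½ε₀} instead of ε₀ … hence U_k
belongs to the space (2) with max{B₃ε₁, ½ε₀} instead of ε₀»*; (b) THE ITERATION, verbatim: *«If ½ε₀ ≦ B₃ε₁, then the required regularity is proved.  If
½ε₀ > B₃ε₁, then we apply again the whole reasoning with ½ε₀ instead of ε₀.  We continue this way until we reach the bound B₃ε₁.»*  Move (b) is kernel
bookkeeping; r08 certified it over the ABSTRACT carrier (`B11Prop8Assembly.prop8Printed_of_halvingStep`).  This file certifies (b) AT NODE 00's OBJECTS in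
the currency the K0 road displays (`Prop8RegSepTopStep`: def-P11's top-domain class (6) on `Sect2.omegaPlaqsTop ∕ omegaBondsTop`, LEVEL-DEPENDENT data
thresholds `δ_n` comparable both ways (C′), curve-criticality on the fibre), so that the K0 road's N07 debt READS «Sect. F's one-step improvement at objects»
(`HalvingStepTop`) instead of «Prop. 8».

LOCATED (typing point, displayed — not a defect of any landed file).  With def-P11's LEVEL-DEPENDENT thresholds `δ_n` the printed iteration LEAVES print's
single-radius spaces (2)∕(6) after one step: the improved radius at level `n` is `max{B₃δ_n, ½ε₀}`, a function of `n`.  A step typed with a SCALAR class radius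
in and out can therefore only be iterated while `ε₀∕2^m ≥ B₃·max_n δ_n`, and reaches (8) with `B₃·max_n δ_n` at EVERY level — off by up to `2^k` from the typed
conclusion `B₃δ_n` under C′.  Hence the object-level step is typed with LEVEL-DEPENDENT class radii `ε : ℕ → ℝ` (`ε_n·η_n²` for (1.7), `ε_n·η_n³` for (1.9)),
sandwiched `B₃δ_n ≤ ε_n ≤ a₀` and 2-COMPARABLE BOTH WAYS exactly like the data (these are the radii `max{B₃δ_n, ε₀∕2^m}` the iteration visits); print's
argument is LOCAL (p. 302: *«They are local, and for a plaquette p, or a bond b, we take a unit cube Δ₀ ⊂ B_j(Λ_j) containing p or b»*) and reads the class and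
the data on the collared cube, i.e. on levels `j − 1`, `j` only ((144)), where two-sided comparability bounds both by twice their level-`j` values — so the
comparability binders are what a level-local discharge consumes, and print's own single-`ε₀` ∕ single-`ε₁` step is the instance `ε ≡ ε₀`, `δ ≡ ε₁`.

CONTENTS.  §1 ★★ `HalvingStepTop F N Sup B₃ a₀ a₁` (NAMED FACT, never asserted) + `HalvingStepTop.of_le`.  §2 ★ `classTop_iterate_of_halvingStepTop` («we continue
this way»: the class at radii `max{B₃δ_n, ε₀∕2^m}` for every `m`, by induction).  §3 ★★ `prop8RegSepTopStep_of_halvingStepTop` («until we reach the bound B₃ε₁»,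
level by level) and the minimiser form `regular_of_isMinimizer_classTop_of_halvingStepTop`.  §4 the converse `halvingStepTop_of_prop8RegSepTopStep`
(monotonicity at `ε₀ := a₀`) and ★ `halvingStepTop_iff_prop8RegSepTopStep`: the halving form is a REFORMULATION of the top step exposing the
single-pass estimate Sect. F proves — logically equivalent for `0 < B₃`, nothing weakened or smuggled; floors transfer both ways.

HONEST FRAMING: one named fact (a `Prop`, never asserted) + kernel bookkeeping (an induction on `m` and real-number inequalities between maxima); NOTHING of
Bałaban's analysis is proved; `stub_prop8StepCoP13` ∕ K0⁷ NOT closed; N07 NOT discharged; counts unmoved (5∕27); one finite T⁴ programme at fixed ε — NOT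
continuum ∕ ℝ⁴ ∕ OS ∕ mass gap ∕ Clay.  READING displayed (unchanged from p524052): criticality in the CURVE form (GAP-STATED(submersion), ref-C READ-121 NOTE 2);
floors of record for any consumer taking the facts as hypotheses: `2L² ≤ B₃` (dag-n21-c `two_sq_L_le_of_prop8RegSepTopStep`), `0 < ν.M₁` (binder).
No `sorry`, no `instance`, no `notation`.
-/

noncomputable section

namespace Literature.MathematicalPhysics.QuantumFieldTheory.Balaban1983to89.Node00

open T4Continuum (T4Family)
open B15DeterminingSets

/-! ## §1  ★★ The one-step local improvement of Sect. F at the objects of record — the named fact -/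

section NamedFactHalvingTop

variable (F : T4Family) (N : ℕ) [NeZero N]

/-- ★★ **[15] SECT. F's ONE-STEP IMPROVEMENT (p. 304 [28], before Prop. 8), AT THE OBJECTS OF RECORD, TOP-DOMAIN reading, `k ≥ 1`, LEVEL-DEPENDENT radii** —
*«we conclude that U′_k satisfies (2) on Δ₀ with max{B₃ε₁, ½ε₀} instead of ε₀.  The cube Δ₀ is an arbitrary cube Δ(y) = B^j(y), if y ∈ Λ_j, hence U_k belongs
to the space (2) with max{B₃ε₁, ½ε₀} instead of ε₀»*, for *«critical configurations of the functional (5) … [in] the spaces (6) with ε₀ sufficiently small»*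
(p. 300), the smallness being «ε₀ ≦ a₅» ((166), M′ = 1) —: in the binder block of `Prop8RegSepTopStep` (separated (2.18) index, `0 < ν.M₁`, `1 ≤ k`; data `W`
with print's (7) on the top-domain concord range, thresholds `0 < δ_n ≤ a₁` comparable BOTH ways), for CLASS RADII `ε : ℕ → ℝ` with `B₃δ_n ≤ ε_n ≤ a₀` and
comparable both ways: a configuration `U` on the fibre of `W`, in the class (6) ON `Ω₀ = Sup ν K s.Ω` at radii `ε_n·η_n²` ((1.7) on `omegaPlaqsTop`) ∕
`ε_n·η_n³` ((1.9) on `omegaBondsTop`), CRITICAL for (5) on that fibre (`IsCritOnFibre`), lies in the same class at the HALVED radii `max{B₃δ_n, ½ε_n}`.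
A `Prop`, NEVER asserted — its content is Sect. F (144)–(168) ([6] Thm 2's gauge (152), (160), the H-kernel bounds (161)–(164), Prop. 6's equation (158),
(165)–(168)); `a₀` plays print's `a₅`.  Print's single-`ε₀`∕single-`ε₁` statement is the instance `ε ≡ ε₀`, `δ ≡ ε₁`; the level-dependent radii and their
two-sided comparability are the typing forced by def-P11's level-dependent `δ_n` (file header, LOCATED) and are what a level-local discharge on the collared
cube (levels `j−1`, `j`, (144)) consumes.
-- TODO(general form): ONE threshold ε₁ and ONE radius ε₀ in print; general admissible `{Ω_j}` ∕ `𝔅_k` of [6] Sect. A; print's (82) tangent criticality.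
[cite: Balaban1985Variational, Sect. F pp.300–304, (144) p.300, (166)–(168) p.304, Prop. 8 p.304, (2)–(8) pp.278–279; Balaban1985RegularSpaces, (1.7)–(1.9) p.77; Balaban1988Convergent, (2.6)–(2.8) pp.255–256, (2.12) p.256] -/
def HalvingStepTop (Sup : (ν : Stage7Numerics) → (K : ℕ) → (ℕ → Set (Site (F.P K) 0)) → Set (Site (F.P K) 0)) (B₃ a₀ a₁ : ℝ) : Prop :=
  ∀ (ν : Stage7Numerics) (M : ℕ) (g : ℕ → ℝ) (K k : ℕ) (s : SeqOfRecord F ν M g K k), Sect2.SeqSeparated ν.M₁ s → 0 < ν.M₁ → 1 ≤ k →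
    ∀ (ε δ : ℕ → ℝ),
    (∀ n, n ≤ k → 0 < δ n ∧ δ n ≤ a₁) → (∀ n, n < k → δ n ≤ 2 * δ (n + 1)) → (∀ n, n < k → δ (n + 1) ≤ 2 * δ n) →
    (∀ n, n ≤ k → B₃ * δ n ≤ ε n ∧ ε n ≤ a₀) → (∀ n, n < k → ε n ≤ 2 * ε (n + 1)) → (∀ n, n < k → ε (n + 1) ≤ 2 * ε n) →
    ∀ W : MSField (F.P K) (SU N), Sect2.DataSmall7PTop (avOfRecord F N K) s.Ω (Sup ν K s.Ω) k δ W →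
      ∀ U : GaugeField (F.P K) 0 (SU N),
        (∀ n, n ≤ k → PlaqSmallOn (Sect2.omegaPlaqsTop s.Ω (Sup ν K s.Ω) n) (ε n * (F.P K).eta n ^ 2) U) →
        (∀ n, n ≤ k → Sect2.CoDivSmallOn (Sect2.omegaBondsTop s.Ω (Sup ν K s.Ω) n) (ε n * (F.P K).eta n ^ 3) U) →
        AgreeOn (genSet s.Ω k) (avgFamily (avOfRecord F N K) U) W →
        IsCritOnFibre F N K (genSet s.Ω k) W U →
        (∀ n, n ≤ k → PlaqSmallOn (Sect2.omegaPlaqsTop s.Ω (Sup ν K s.Ω) n) (max (B₃ * δ n) (ε n / 2) * (F.P K).eta n ^ 2) U) ∧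
          ∀ n, n ≤ k → Sect2.CoDivSmallOn (Sect2.omegaBondsTop s.Ω (Sup ν K s.Ω) n) (max (B₃ * δ n) (ε n / 2) * (F.P K).eta n ^ 3) U

variable {F N}

/-- The one-step fact is antitone in the ceilings `a₀`, `a₁`. [cite: Balaban1985Variational, p.304 before Prop. 8 (bookkeeping)] -/
theorem HalvingStepTop.of_le {Sup : (ν : Stage7Numerics) → (K : ℕ) → (ℕ → Set (Site (F.P K) 0)) → Set (Site (F.P K) 0)} {B₃ a₀ a₀' a₁ a₁' : ℝ}
    (h : HalvingStepTop F N Sup B₃ a₀ a₁) (ha₀ : a₀' ≤ a₀) (ha₁ : a₁' ≤ a₁) : HalvingStepTop F N Sup B₃ a₀' a₁' :=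
  fun ν M g K k s hsep hM₁ hk ε δ hδ hcomp hcomp' hε hεcomp hεcomp' W h7 U h17 h19 hfib hcrit =>
    h ν M g K k s hsep hM₁ hk ε δ (fun n hn => ⟨(hδ n hn).1, (hδ n hn).2.trans ha₁⟩) hcomp hcomp'
      (fun n hn => ⟨(hε n hn).1, (hε n hn).2.trans ha₀⟩) hεcomp hεcomp' W h7 U h17 h19 hfib hcrit

end NamedFactHalvingTop

/-! ## §2  ★ «We continue this way»: the iteration through the radii `max{B₃δ_n, ε₀∕2^m}` -/

section Iteration

variable {F : T4Family} {N : ℕ} [NeZero N]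

/-- `η_n ≥ 0` on the lattices of record. [cite: Balaban1987RG1, (1.1) p.260 (bookkeeping)] -/
private theorem eta_nonneg' (P : Params) (n : ℕ) : 0 ≤ P.eta n := by
  unfold Params.eta
  exact pow_nonneg (inv_nonneg.mpr (Nat.cast_nonneg _)) n

/-- Weakening the threshold of the record's `PlaqSmallOn`. [cite: Balaban1988Convergent, (1.4) p.247 (bookkeeping)] -/
private theorem plaqSmallOn_of_le' {P : Params} {j : ℕ} {G : Type*} [GaugeGroup G] {S : Set (Plaq P j)} {δ δ' : ℝ} {U : GaugeField P j G}
    (h : PlaqSmallOn S δ U) (hδ : δ ≤ δ') : PlaqSmallOn S δ' U :=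
  fun p hp => (h p hp).trans_le hδ

/-- The radii the iteration visits are 2-comparable in the level whenever the thresholds are: `max{B₃δ, c} ≤ 2·max{B₃δ′, c}` from `δ ≤ 2δ′`, `B₃, c ≥ 0`.
[cite: Balaban1985Variational, p.304 before Prop. 8 (bookkeeping)] -/
private theorem max_le_two_mul_max {B₃ c d d' : ℝ} (hB₃ : 0 ≤ B₃) (hc : 0 ≤ c) (hd : d ≤ 2 * d') :
    max (B₃ * d) c ≤ 2 * max (B₃ * d') c := by
  refine max_le ?_ ?_
  · calc B₃ * d ≤ B₃ * (2 * d') := mul_le_mul_of_nonneg_left hd hB₃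
      _ = 2 * (B₃ * d') := by ring
      _ ≤ 2 * max (B₃ * d') c := mul_le_mul_of_nonneg_left (le_max_left _ _) zero_le_two
  · calc c ≤ 2 * c := le_mul_of_one_le_left hc one_le_two
      _ ≤ 2 * max (B₃ * d') c := mul_le_mul_of_nonneg_left (le_max_right _ _) zero_le_two

/-- ★ **«WE CONTINUE THIS WAY» AT THE OBJECTS OF RECORD** (p. 304 [28]): under the hypotheses of `Prop8RegSepTopStep` (class (6) on `Ω₀` at the SCALAR radius
`ε₀` with `B₃δ_n ≤ ε₀ ≤ a₀`, data (7) at `δ`, `U` on the fibre and critical on it), the one-step fact gives, for every `m`, the class at the LEVEL-DEPENDENT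
radii `max{B₃δ_n, ε₀∕2^m}` — by induction on `m`: `m = 0` is the weakening `ε₀ ≤ max{B₃δ_n, ε₀}`; at `m + 1` the step is applied at the radii
`ε_n := max{B₃δ_n, ε₀∕2^m}` (sandwiched `B₃δ_n ≤ ε_n ≤ a₀` by `B11Prop8Assembly.stage_le`, 2-comparable both ways because `δ` is) and its output
`max{B₃δ_n, ½ε_n}` is at most `max{B₃δ_n, ε₀∕2^{m+1}}` (`B11Prop8Assembly.max_half_le`).
[cite: Balaban1985Variational, p.304 before Prop. 8; Balaban1985RegularSpaces, (1.7)–(1.9) p.77] -/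
theorem classTop_iterate_of_halvingStepTop {Sup : (ν : Stage7Numerics) → (K : ℕ) → (ℕ → Set (Site (F.P K) 0)) → Set (Site (F.P K) 0)}
    {B₃ a₀ a₁ : ℝ} (hB₃ : 0 ≤ B₃) (h : HalvingStepTop F N Sup B₃ a₀ a₁) (ν : Stage7Numerics) (M : ℕ) (g : ℕ → ℝ) (K k : ℕ)
    (s : SeqOfRecord F ν M g K k) (hsep : Sect2.SeqSeparated ν.M₁ s) (hM₁ : 0 < ν.M₁) (hk : 1 ≤ k) (ε₀ : ℝ) (δ : ℕ → ℝ)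
    (hδ : ∀ n, n ≤ k → 0 < δ n ∧ δ n ≤ a₁ ∧ B₃ * δ n ≤ ε₀) (hcomp : ∀ n, n < k → δ n ≤ 2 * δ (n + 1))
    (hcomp' : ∀ n, n < k → δ (n + 1) ≤ 2 * δ n) (hε₀ : ε₀ ≤ a₀) (W : MSField (F.P K) (SU N))
    (h7 : Sect2.DataSmall7PTop (avOfRecord F N K) s.Ω (Sup ν K s.Ω) k δ W) (U : GaugeField (F.P K) 0 (SU N))
    (h17 : ∀ n, n ≤ k → PlaqSmallOn (Sect2.omegaPlaqsTop s.Ω (Sup ν K s.Ω) n) (ε₀ * (F.P K).eta n ^ 2) U)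
    (h19 : Sect2.CoDivClassOnTop s.Ω (Sup ν K s.Ω) k ε₀ U) (hfib : AgreeOn (genSet s.Ω k) (avgFamily (avOfRecord F N K) U) W)
    (hcrit : IsCritOnFibre F N K (genSet s.Ω k) W U) (m : ℕ) :
    (∀ n, n ≤ k → PlaqSmallOn (Sect2.omegaPlaqsTop s.Ω (Sup ν K s.Ω) n) (max (B₃ * δ n) (ε₀ / 2 ^ m) * (F.P K).eta n ^ 2) U) ∧
      ∀ n, n ≤ k → Sect2.CoDivSmallOn (Sect2.omegaBondsTop s.Ω (Sup ν K s.Ω) n) (max (B₃ * δ n) (ε₀ / 2 ^ m) * (F.P K).eta n ^ 3) U := by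
  have hη : ∀ n, 0 ≤ (F.P K).eta n := eta_nonneg' (F.P K)
  -- `0 ≤ B₃δ_0 ≤ ε₀`: the starting radius is non-negative
  have hε₀nn : 0 ≤ ε₀ := (mul_nonneg hB₃ (hδ 0 (Nat.zero_le _)).1.le).trans (hδ 0 (Nat.zero_le _)).2.2
  induction m with
  | zero =>
    -- the weakening `ε₀ ≤ max{B₃δ_n, ε₀}`
    have hle : ∀ n, ε₀ ≤ max (B₃ * δ n) (ε₀ / 2 ^ 0) := fun n => by
      rw [pow_zero, div_one]
      exact le_max_right _ _
    exact ⟨fun n hn => plaqSmallOn_of_le' (h17 n hn) (mul_le_mul_of_nonneg_right (hle n) (pow_nonneg (hη n) 2)),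
      fun n hn => (h19 n hn).of_le (mul_le_mul_of_nonneg_right (hle n) (pow_nonneg (hη n) 3))⟩
  | succ m ih =>
    -- «we apply again the whole reasoning with ½ε₀ instead of ε₀», at the radii `ε_n := max{B₃δ_n, ε₀/2^m}`
    have hc : 0 ≤ ε₀ / 2 ^ m := div_nonneg hε₀nn (pow_nonneg zero_le_two m)
    have hεblk : ∀ n, n ≤ k → B₃ * δ n ≤ max (B₃ * δ n) (ε₀ / 2 ^ m) ∧ max (B₃ * δ n) (ε₀ / 2 ^ m) ≤ a₀ := fun n hn =>
      ⟨le_max_left _ _, (B11Prop8Assembly.stage_le (hδ n hn).2.2 hε₀nn m).trans hε₀⟩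
    have hεcomp : ∀ n, n < k → max (B₃ * δ n) (ε₀ / 2 ^ m) ≤ 2 * max (B₃ * δ (n + 1)) (ε₀ / 2 ^ m) := fun n hn =>
      max_le_two_mul_max hB₃ hc (hcomp n hn)
    have hεcomp' : ∀ n, n < k → max (B₃ * δ (n + 1)) (ε₀ / 2 ^ m) ≤ 2 * max (B₃ * δ n) (ε₀ / 2 ^ m) := fun n hn =>
      max_le_two_mul_max hB₃ hc (hcomp' n hn)
    obtain ⟨hP, hD⟩ := h ν M g K k s hsep hM₁ hk (fun n => max (B₃ * δ n) (ε₀ / 2 ^ m)) δ (fun n hn => ⟨(hδ n hn).1, (hδ n hn).2.1⟩) hcomp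
      hcomp' hεblk hεcomp hεcomp' W h7 U ih.1 ih.2 hfib hcrit
    -- the output radius `max{B₃δ_n, ½·max{B₃δ_n, ε₀/2^m}} ≤ max{B₃δ_n, ε₀/2^{m+1}}`
    have hhalf : ∀ n, n ≤ k → max (B₃ * δ n) (max (B₃ * δ n) (ε₀ / 2 ^ m) / 2) ≤ max (B₃ * δ n) (ε₀ / 2 ^ (m + 1)) := fun n hn =>
      B11Prop8Assembly.max_half_le (mul_nonneg hB₃ (hδ n hn).1.le) m
    exact ⟨fun n hn => plaqSmallOn_of_le' (hP n hn) (mul_le_mul_of_nonneg_right (hhalf n hn) (pow_nonneg (hη n) 2)),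
      fun n hn => (hD n hn).of_le (mul_le_mul_of_nonneg_right (hhalf n hn) (pow_nonneg (hη n) 3))⟩

end Iteration

/-! ## §3  ★★ «Until we reach the bound B₃ε₁»: Proposition 8's top step from the one-step fact -/

section Prop8FromHalving

variable {F : T4Family} {N : ℕ} [NeZero N]

/-- ★★ **[15] PROPOSITION 8's TOP STEP FROM SECT. F's ONE-STEP IMPROVEMENT, AT THE OBJECTS OF RECORD** (p. 304 [28], *«We continue this way until we reach the
bound B₃ε₁.  Let us formulate this result in Proposition 8»*): for `0 < B₃` the named fact `Prop8RegSepTopStep F N Sup B₃ a₀ a₁` (p524052) follows from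
`HalvingStepTop F N Sup B₃ a₀ a₁` with THE SAME constants — LEVEL BY LEVEL: for each `n ≤ k` the radii `max{B₃δ_n, ε₀∕2^m}` of `classTop_iterate_of_halvingStepTop`
reach `B₃δ_n` after finitely many halvings (`B11.halving_reaches_B3eps1`, `0 < B₃δ_n`).  The object-level twin of r08's `B11Prop8Assembly.prop8Printed_of_halvingStep`.
After this theorem the K0 road's N07 debt (plan V14 `stub_prop8StepCoP13`) reads: Sect. F's one-step local improvement (144)–(168) at NODE 00's objects.
[cite: Balaban1985Variational, Prop. 8 p.304, Sect. F pp.300–304; Balaban1985RegularSpaces, (1.7)–(1.9) p.77; Balaban1988Convergent, (2.6)–(2.8) pp.255–256] -/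
theorem prop8RegSepTopStep_of_halvingStepTop {Sup : (ν : Stage7Numerics) → (K : ℕ) → (ℕ → Set (Site (F.P K) 0)) → Set (Site (F.P K) 0)}
    {B₃ a₀ a₁ : ℝ} (hB₃ : 0 < B₃) (h : HalvingStepTop F N Sup B₃ a₀ a₁) : Prop8RegSepTopStep F N Sup B₃ a₀ a₁ := by
  intro ν M g K k s hsep hM₁ hk ε₀ δ hδ hcomp hcomp' hε₀ W h7 U h17 h19 hfib hcrit
  have hit := classTop_iterate_of_halvingStepTop hB₃.le h ν M g K k s hsep hM₁ hk ε₀ δ hδ hcomp hcomp' hε₀ W h7 U h17 h19 hfib hcrit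
  refine ⟨fun n hn => ?_, fun n hn => ?_⟩
  · obtain ⟨m, hm⟩ := B11.halving_reaches_B3eps1 ε₀ (B₃ * δ n) (mul_pos hB₃ (hδ n hn).1)
    have hP := (hit m).1 n hn
    rwa [hm] at hP
  · obtain ⟨m, hm⟩ := B11.halving_reaches_B3eps1 ε₀ (B₃ * δ n) (mul_pos hB₃ (hδ n hn).1)
    have hD := (hit m).2 n hn
    rwa [hm] at hD

/-- ★ **THE TOP-DOMAIN THEOREM-1 SENTENCE AT A GENUINE STEP FROM SECT. F's ONE-STEP IMPROVEMENT** (minimiser form): for `k ≥ 1`, a separated index, `0 < ν.M₁`,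
thresholds comparable both ways with `B₃δ_n ≤ ε₀ ≤ a₀`, a datum with print's (7) on the top-domain range, every minimiser of (2.12) over print's class (6) ON
`Ω₀` at `ε₀` on the fibre of `W` lies in (8) on `Ω₀` — minimal ⇒ critical on the fibre (p524052 §1) ⇒ halving iteration (this file) —, for `0 < B₃`.
[cite: Balaban1985Variational, Thm 1 (6)–(8) pp.278–279, p.299, Prop. 8 p.304; Balaban1988Convergent, (2.12) p.256] -/
theorem regular_of_isMinimizer_classTop_of_halvingStepTop {Sup : (ν : Stage7Numerics) → (K : ℕ) → (ℕ → Set (Site (F.P K) 0)) → Set (Site (F.P K) 0)}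
    {B₃ a₀ a₁ : ℝ} (hB₃ : 0 < B₃) (h : HalvingStepTop F N Sup B₃ a₀ a₁) (ν : Stage7Numerics) (M : ℕ)
    (g : ℕ → ℝ) (K k : ℕ) (s : SeqOfRecord F ν M g K k) (hsep : Sect2.SeqSeparated ν.M₁ s) (hM₁ : 0 < ν.M₁) (hk : 1 ≤ k) (ε₀ : ℝ)
    (δ : ℕ → ℝ) (hδ : ∀ n, n ≤ k → 0 < δ n ∧ δ n ≤ a₁ ∧ B₃ * δ n ≤ ε₀) (hcomp : ∀ n, n < k → δ n ≤ 2 * δ (n + 1))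
    (hcomp' : ∀ n, n < k → δ (n + 1) ≤ 2 * δ n) (hε₀ : ε₀ ≤ a₀)
    (W : MSField (F.P K) (SU N)) (h7 : Sect2.DataSmall7PTop (avOfRecord F N K) s.Ω (Sup ν K s.Ω) k δ W) {U₀ : GaugeField (F.P K) 0 (SU N)}
    (hU₀ : IsMinimizer (avOfRecord F N K)
      {U | (∀ n, n ≤ k → PlaqSmallOn (Sect2.omegaPlaqsTop s.Ω (Sup ν K s.Ω) n) (ε₀ * (F.P K).eta n ^ 2) U) ∧
        Sect2.CoDivClassOnTop s.Ω (Sup ν K s.Ω) k ε₀ U} (genSet s.Ω k) W U₀) :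
    (∀ n, n ≤ k → PlaqSmallOn (Sect2.omegaPlaqsTop s.Ω (Sup ν K s.Ω) n) (B₃ * δ n * (F.P K).eta n ^ 2) U₀) ∧
      ∀ n, n ≤ k → Sect2.CoDivSmallOn (Sect2.omegaBondsTop s.Ω (Sup ν K s.Ω) n) (B₃ * δ n * (F.P K).eta n ^ 3) U₀ :=
  regular_of_isMinimizer_classTop_of_prop8TopStep (prop8RegSepTopStep_of_halvingStepTop hB₃ h) ν M g K k s hsep hM₁ hk ε₀ δ hδ hcomp hcomp' hε₀ W h7
    hU₀

end Prop8FromHalving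

/-! ## §4  The converse (bookkeeping): the one-step fact is a REFORMULATION of Proposition 8's top step, not a weakening -/

section HalvingFromProp8

variable {F : T4Family} {N : ℕ} [NeZero N]

/-- **THE CONVERSE** — Proposition 8's top step implies the one-step fact with the same constants: a configuration in the class at
level-dependent radii `ε_n ≤ a₀` lies in the class at the SCALAR radius `a₀` (monotonicity), Prop. 8 at `ε₀ := a₀` (`B₃δ_n ≤ ε_n ≤ a₀`)
puts it in (8) at `B₃δ_n`, and `B₃δ_n ≤ max{B₃δ_n, ½ε_n}`.  No sign hypothesis.  HONEST READING: together with
`prop8RegSepTopStep_of_halvingStepTop` this says the halving form is LOGICALLY EQUIVALENT to the top step (for `0 < B₃`) — it re-displays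
N07's debt in the shape Sect. F proves in ONE pass ((144)–(168)), it does not shrink it; floors of record transfer both ways
(`2L² ≤ B₃`, dag-n21-c). [cite: Balaban1985Variational, Prop. 8 p.304, Sect. F pp.300–304 (bookkeeping)] -/
theorem halvingStepTop_of_prop8RegSepTopStep {Sup : (ν : Stage7Numerics) → (K : ℕ) → (ℕ → Set (Site (F.P K) 0)) → Set (Site (F.P K) 0)}
    {B₃ a₀ a₁ : ℝ} (h : Prop8RegSepTopStep F N Sup B₃ a₀ a₁) : HalvingStepTop F N Sup B₃ a₀ a₁ := by
  intro ν M g K k s hsep hM₁ hk ε δ hδ hcomp hcomp' hε _hεcomp _hεcomp' W h7 U h17 h19 hfib hcrit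
  have hη : ∀ n, 0 ≤ (F.P K).eta n := eta_nonneg' (F.P K)
  -- the class at radii `ε_n ≤ a₀` lies in the class at the scalar radius `a₀`
  have h17' : ∀ n, n ≤ k → PlaqSmallOn (Sect2.omegaPlaqsTop s.Ω (Sup ν K s.Ω) n) (a₀ * (F.P K).eta n ^ 2) U := fun n hn =>
    plaqSmallOn_of_le' (h17 n hn) (mul_le_mul_of_nonneg_right (hε n hn).2 (pow_nonneg (hη n) 2))
  have h19' : Sect2.CoDivClassOnTop s.Ω (Sup ν K s.Ω) k a₀ U := fun n hn =>
    (h19 n hn).of_le (mul_le_mul_of_nonneg_right (hε n hn).2 (pow_nonneg (hη n) 3))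
  obtain ⟨hP, hD⟩ := h ν M g K k s hsep hM₁ hk a₀ δ (fun n hn => ⟨(hδ n hn).1, (hδ n hn).2, (hε n hn).1.trans (hε n hn).2⟩)
    hcomp hcomp' le_rfl W h7 U h17' h19' hfib hcrit
  exact ⟨fun n hn => plaqSmallOn_of_le' (hP n hn) (mul_le_mul_of_nonneg_right (le_max_left _ _) (pow_nonneg (hη n) 2)),
    fun n hn => (hD n hn).of_le (mul_le_mul_of_nonneg_right (le_max_left _ _) (pow_nonneg (hη n) 3))⟩

/-- ★ **EQUIVALENCE** (for `0 < B₃`): Sect. F's one-step improvement at the objects of record ⟺ [15] Proposition 8's top step there.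
The reduction of module 30 loses and smuggles nothing; what it buys is the INTERFACE a discharge meets — the single-pass local estimate
of Sect. F —, with print's iteration supplied by the kernel. [cite: Balaban1985Variational, Prop. 8 p.304, Sect. F pp.300–304 (bookkeeping)] -/
theorem halvingStepTop_iff_prop8RegSepTopStep {Sup : (ν : Stage7Numerics) → (K : ℕ) → (ℕ → Set (Site (F.P K) 0)) → Set (Site (F.P K) 0)}
    {B₃ a₀ a₁ : ℝ} (hB₃ : 0 < B₃) : HalvingStepTop F N Sup B₃ a₀ a₁ ↔ Prop8RegSepTopStep F N Sup B₃ a₀ a₁ :=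
  ⟨prop8RegSepTopStep_of_halvingStepTop hB₃, halvingStepTop_of_prop8RegSepTopStep⟩

end HalvingFromProp8

end Literature.MathematicalPhysics.QuantumFieldTheory.Balaban1983to89.Node00

end
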